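import Mathlib
import HarnessLib
import Literature.MathematicalPhysics.QuantumFieldTheory.TphiSeminormExpSecond
import Literature.MathematicalPhysics.StatisticalMechanics.StrongNormExpLipschitz

/-!
# Second-order bound for the exponential map into the strong norm ([ABKM19] Lemma 9.3, `D²E` bound):
# `|e^{∓H(B)} − 1 ± H(B)|_{T_φ} ≤ 256 e^{1/4} ‖H‖²_{k,0} W(φ)` for `‖H‖_{k,0} ≤ ⅛`

[ABKM19] Lemma 9.3 bounds `D²E(H)(Ḣ,Ḣ) = e^{H}Ḣ²` on a ball, so the second-order Taylor remainder
of `E` at `0`, block by block `e^{H(B)} − 1 − H(B)`, is `O(‖H‖²_{k,0})` in the strong norm.  This is the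
ingredient that makes the `H`-derivative of the irrelevant part of the renormalisation map vanish at
the origin (`D_H S_k(0,0) = 0`, Theorem 6.8) quantitatively.  We derive it from the `T_φ` estimate
`‖e^F − 1 − F‖_{T_φ} ≤ ‖F‖²_{T_φ}e^{‖F‖_{T_φ}}` (`TphiSeminormExpSecond`) and the `ℓ²` domination
`|H(B)|_{T_φ} ≤ 2(1 + N(φ)²)‖H‖_{k,0}`, `e^{N²/2} ≤ W(φ)`.

* `tayNorm_cexp_sub_one_sub_le` — `‖e^F − 1 − F‖_{T_φ} ≤ ‖F‖²_{T_φ}e^{‖F‖_{T_φ}}` for any gauge;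
* **`tayNormLE_cexp_eval_sub_one_sub`** — abstract `ℓ²`-dominating weight;
* **`tayNormLE_cexp_neg_eval_sub_one_add`** — `e^{−H(B)} − 1 + H(B)`;
* **`tayNormLE_expNegH_sub_one_add_strong_abkm`** — the torus tower's strong weight `W_k^B`.

Everything is proved; no named fact.

## References
* S. Adams, S. Buchholz, R. Kotecký, S. Müller, arXiv:1910.13564, Lemma 9.3 (9.13), Theorem 6.8
  [AdamsBuchholzKoteckyMuller2019].
-/

noncomputable section

namespace Literature.MathematicalPhysics.StatisticalMechanics.GradientRG

open scoped BigOperators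
open Finset
open Literature.MathematicalPhysics.QuantumFieldTheory
open Literature.MathematicalPhysics.StatisticalMechanics.TorusPolymer (blockOf)

section Generic

variable {E V : Type*} [NormedAddCommGroup E] [NormedSpace ℝ E] [FiniteDimensional ℝ E]
  [NormedAddCommGroup V] [NormedSpace ℝ V]

/-- **`‖e^F − 1 − F‖_{T_φ} ≤ ‖F‖²_{T_φ} e^{‖F‖_{T_φ}}`** relative to any gauge (complex `C^{r₀}` `F`).
[cite: AdamsBuchholzKoteckyMuller2019, Lemma 9.3 (9.13)] -/
theorem tayNorm_cexp_sub_one_sub_le (T : E →ₗ[ℝ] V) {r₀ : ℕ} {F : E → ℂ} (hF : ContDiff ℝ r₀ F)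
    (φ : E) :
    tayNorm T r₀ (fun ψ => Complex.exp (F ψ) - 1 - F ψ) φ ≤
      tayNorm T r₀ F φ ^ 2 * Real.exp (tayNorm T r₀ F φ) := by
  rw [tayNorm_eq_tphiSeminorm, tayNorm_eq_tphiSeminorm]
  exact tphiSeminorm_cexp_sub_one_sub_le r₀ zero_le_one (contDiff_gaugeLift T hF) _

end Generic

variable {𝕜 : Type*} {d M : ℕ} [NeZero M]

/-- `(1 + N²)² ≤ 64 e^{N²/4}`. [folklore] -/
private theorem one_add_sq_sq_le (N : ℝ) : (1 + N ^ 2) ^ 2 ≤ 64 * Real.exp (N ^ 2 / 4) := by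
  have h1 : 1 + N ^ 2 ≤ 8 * Real.exp (N ^ 2 / 8) := by
    have := Real.add_one_le_exp (N ^ 2 / 8)
    nlinarith [sq_nonneg N]
  have h0 : 0 ≤ 1 + N ^ 2 := by positivity
  have hsq : Real.exp (N ^ 2 / 8) * Real.exp (N ^ 2 / 8) = Real.exp (N ^ 2 / 4) := by
    rw [← Real.exp_add]; ring_nf
  calc (1 + N ^ 2) ^ 2 ≤ (8 * Real.exp (N ^ 2 / 8)) ^ 2 := pow_le_pow_left₀ h0 h1 2
    _ = 64 * Real.exp (N ^ 2 / 4) := by rw [mul_pow, ← hsq]; ring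

/-- **Second-order bound of `E` into the strong norm**: for an `ℓ²`-dominating weight `W` and
`‖H‖_{k,0} ≤ ⅛`, `‖e^{H(B)} − 1 − H(B)‖_{T, W} ≤ 256 e^{1/4} ‖H‖²_{k,0}`.
[cite: AdamsBuchholzKoteckyMuller2019, Lemma 9.3 (9.13)] -/
theorem tayNormLE_cexp_eval_sub_one_sub {𝔥 R : ℝ} (h𝔥 : 0 < 𝔥) (hR : 0 < R) {p : ℕ}
    (hp : d / 2 + 1 ≤ p) {S B : Finset (Fin d → ZMod M)} (hBS : B ⊆ S)
    {W : ((Fin d → ZMod M) → ℝ) → ℝ} (hW : Ell2Dominates B 𝔥 R W) {H : RelevantHamiltonian ℂ d}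
    (r₀ : ℕ) (hH : hamNorm 𝔥 R B.card H ≤ 1 / 8) :
    TayNormLE (fieldGauge 𝔥 R p S) r₀ W
      (fun ψ : (Fin d → ZMod M) → ℝ => Complex.exp (eval H B ψ) - 1 - eval H B ψ)
      (256 * Real.exp (1 / 4) * hamNorm 𝔥 R B.card H ^ 2) := by
  intro φ
  obtain ⟨N, hN0, hNlin, hNgrad, hNW⟩ := hW φ
  set nH := hamNorm 𝔥 R B.card H with hnH
  have hH0 : 0 ≤ nH := hamNorm_nonneg h𝔥.le hR.le _ _
  set t := tayNorm (fieldGauge 𝔥 R p S) r₀ (fun ψ : (Fin d → ZMod M) → ℝ => eval H B ψ) φ with ht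
  have ht0 : 0 ≤ t := tayNorm_nonneg _ _ _ _
  have h1 : t ≤ (1 + N ^ 2) * (2 * nH) :=
    tayNorm_eval_le_quarter (𝕜 := ℂ) h𝔥 hR hp hBS (H := H) (r₀ := r₀) hN0 hNlin hNgrad
  have h2 := tayNorm_cexp_sub_one_sub_le (fieldGauge 𝔥 R p S) (contDiff_eval H B (n := r₀)) φ
  refine h2.trans ?_
  rw [← ht]
  have hN2 : 0 ≤ 1 + N ^ 2 := by positivity
  have ht4 : t ≤ 1 / 4 + N ^ 2 / 4 := by
    have : (1 + N ^ 2) * (2 * nH) ≤ (1 + N ^ 2) * (2 * (1 / 8)) :=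
      mul_le_mul_of_nonneg_left (by linarith) hN2
    linarith
  have hexp : Real.exp t ≤ Real.exp (1 / 4) * Real.exp (N ^ 2 / 4) := by
    rw [← Real.exp_add]; exact Real.exp_le_exp.2 ht4
  have htsq : t ^ 2 ≤ (1 + N ^ 2) ^ 2 * (4 * nH ^ 2) := by
    have := pow_le_pow_left₀ ht0 h1 2
    calc t ^ 2 ≤ ((1 + N ^ 2) * (2 * nH)) ^ 2 := this
      _ = (1 + N ^ 2) ^ 2 * (4 * nH ^ 2) := by ring
  have hq := one_add_sq_sq_le N
  have hsq : Real.exp (N ^ 2 / 4) * Real.exp (N ^ 2 / 4) = Real.exp (N ^ 2 / 2) := by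
    rw [← Real.exp_add]; ring_nf
  calc t ^ 2 * Real.exp t ≤ ((1 + N ^ 2) ^ 2 * (4 * nH ^ 2)) * (Real.exp (1 / 4) * Real.exp (N ^ 2 / 4)) :=
        mul_le_mul htsq hexp (Real.exp_pos _).le (by positivity)
    _ ≤ (64 * Real.exp (N ^ 2 / 4) * (4 * nH ^ 2)) * (Real.exp (1 / 4) * Real.exp (N ^ 2 / 4)) := by
        gcongr
    _ = 256 * Real.exp (1 / 4) * nH ^ 2 * (Real.exp (N ^ 2 / 4) * Real.exp (N ^ 2 / 4)) := by ring
    _ = 256 * Real.exp (1 / 4) * nH ^ 2 * Real.exp (N ^ 2 / 2) := by rw [hsq]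
    _ ≤ 256 * Real.exp (1 / 4) * nH ^ 2 * W φ := mul_le_mul_of_nonneg_left hNW (by positivity)

/-- **Second-order bound for the Boltzmann factor**: `‖e^{−H(B)} − 1 + H(B)‖_{T, W} ≤ 256e^{1/4}‖H‖²_{k,0}`
for `‖H‖_{k,0} ≤ ⅛`. [cite: AdamsBuchholzKoteckyMuller2019, Lemma 9.3 (9.13)] -/
theorem tayNormLE_cexp_neg_eval_sub_one_add {𝔥 R : ℝ} (h𝔥 : 0 < 𝔥) (hR : 0 < R) {p : ℕ}
    (hp : d / 2 + 1 ≤ p) {S B : Finset (Fin d → ZMod M)} (hBS : B ⊆ S)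
    {W : ((Fin d → ZMod M) → ℝ) → ℝ} (hW : Ell2Dominates B 𝔥 R W) {H : RelevantHamiltonian ℂ d}
    (r₀ : ℕ) (hH : hamNorm 𝔥 R B.card H ≤ 1 / 8) :
    TayNormLE (fieldGauge 𝔥 R p S) r₀ W
      (fun ψ : (Fin d → ZMod M) → ℝ => Complex.exp (-(eval H B ψ)) - 1 + eval H B ψ)
      (256 * Real.exp (1 / 4) * hamNorm 𝔥 R B.card H ^ 2) := by
  have hfun : (fun ψ : (Fin d → ZMod M) → ℝ => Complex.exp (-(eval H B ψ)) - 1 + eval H B ψ) =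
      fun ψ => Complex.exp (eval (-H) B ψ) - 1 - eval (-H) B ψ := by
    funext ψ; rw [eval_neg, sub_neg_eq_add]
  rw [hfun, ← hamNorm_neg 𝔥 R B.card H]
  exact tayNormLE_cexp_eval_sub_one_sub h𝔥 hR hp hBS hW r₀ (by rwa [hamNorm_neg])

/-- **Second-order bound of `E` for the torus tower**: on the block `B = B_x` at scale `k ≤ N`, with
the strong weight `W_k^B` of [ABKM19] and `‖H‖_{k,0} ≤ ⅛` (at `(𝔥_k, L^k, |B|)`):
`‖e^{−H(B)} − 1 + H(B)‖_{T, W_k^B} ≤ 256e^{1/4}‖H‖²_{k,0}`.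
[cite: AdamsBuchholzKoteckyMuller2019, Lemma 9.3 (9.13)] -/
theorem tayNormLE_expNegH_sub_one_add_strong_abkm {L N Mord R k p : ℕ} {h : ℝ} (hd : 2 ≤ d)
    (hLodd : Odd L) (hM : M = L ^ N) (hk : k ≤ N) (hh : 0 < h) (hMord : d / 2 + 1 ≤ Mord)
    (hp : d / 2 + 1 ≤ p) {x : Fin d → ZMod M} {S : Finset (Fin d → ZMod M)}
    (hBS : blockOf (L ^ k) x ⊆ S) {H : RelevantHamiltonian ℂ d} (r₀ : ℕ)
    (hH : hamNorm (fieldWt h (L : ℝ) d k) ((L : ℝ) ^ k) (blockOf (L ^ k) x).card H ≤ 1 / 8) :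
    TayNormLE (fieldGauge (fieldWt h (L : ℝ) d k) ((L : ℝ) ^ k) p S) r₀
      (expWeight (strongCoef h N k • derivForm (L : ℝ) k (diffIndex d Mord)
        (boxDensity (boxRad R L k) (boxWt (L : ℝ) d k) (blockOf (L ^ k) x))))
      (fun ψ : (Fin d → ZMod M) → ℝ =>
        expNegH H (blockOf (L ^ k) x) ψ - 1 + eval H (blockOf (L ^ k) x) ψ)
      (256 * Real.exp (1 / 4) *
        hamNorm (fieldWt h (L : ℝ) d k) ((L : ℝ) ^ k) (blockOf (L ^ k) x).card H ^ 2) := by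
  have hL0 : (0 : ℝ) < L := by exact_mod_cast hLodd.pos
  exact tayNormLE_cexp_neg_eval_sub_one_add (fieldWt_pos hh hL0 d k) (by positivity) hp hBS
    (ell2Dominates_strongWeight_abkm (R := R) hd hLodd hM hk hh hMord x) r₀ hH

end Literature.MathematicalPhysics.StatisticalMechanics.GradientRG

end
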